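import Summits.QuantumAdvantage.QuantumAdvantage.Theorems.CubicForrelationSignedExactSliceIsLiftDefs
import Summits.QuantumAdvantage.QuantumAdvantage.Theorems.CubicForrelationSignedExactSliceIsLiftStubV
import Summits.QuantumAdvantage.QuantumAdvantage.Theorems.CubicForrelationSignedExactSliceIsLiftStubA
import Summits.QuantumAdvantage.QuantumAdvantage.Theorems.CubicForrelationSignedExactSliceIsLiftStubMoebius
import Summits.QuantumAdvantage.QuantumAdvantage.Theorems.CubicForrelationSignedExactSliceIsLiftStubAnfCircuitAux
import Summits.QuantumAdvantage.QuantumAdvantage.Theorems.CubicForrelationSignedExactSliceIsLiftStubAnfEmitFP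
import Summits.QuantumAdvantage.QuantumAdvantage.Theorems.CubicForrelationSignedExactSliceIsLiftStubCoeffFP
import Summits.QuantumAdvantage.QuantumAdvantage.Theorems.CubicForrelationSignedExactSliceIsLiftStubCanonFP
import Summits.QuantumAdvantage.QuantumAdvantage.Theorems.CubicForrelationSignedExactSliceIsLiftStubGlue
import Literature.Computability.QuantumComplexity.ForrelationMemCorrect
import Literature.Computability.QuantumComplexity.BQPMajorityAmplification

/-!
# Crux K2 `SignedExactSliceIsLift` holds (stmt-QuantumAdvantage-14830, route `QuantumAdvantage/CubicForrelation`, rank 9)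

The route decl `Summit.QuantumAdvantage.QuantumAdvantage.Theses.CubicForrelation.SignedExactSliceIsLift` says:
`NearExactIsExact →` the SIGNED EXACT cubic slice of 2-fold Forrelation (codes of `B₂`-circuit pairs, `k = 2`, `n` even,
both of 𝔽₂-degree `≤ 3`; yes `Φ = 1`, no `Φ = −1`; `= signedExactCubicForrelationProblem 2` by `rfl`) lies in
`promiseLift BQP`, i.e. some honest, everywhere-gapped `BQP` LANGUAGE contains every `Φ = 1` code and no `Φ = −1` code.
This is the LOCAL LIFT that puts the isolation crux r2 `NearExactIsExact` into the cone of the deciding theorem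
`closes (r2) (K2) (r3)` without the global, relativised-false lift `PlLift`.

LINE `Sketch` (idea `reduce-then-lift`, Cruxes/SignedExactSliceIsLift/PICKED.md). K2 is CLOSURE OF `PromiseBQP` UNDER A
TOTAL KARP REDUCTION whose image lies inside the promise of a θ-gapped problem (`promiseLift_of_total_reduction`):
* the Möbius CANONICALISER `f ∈ FP` (`totalCanonicaliser` = `stub_glue stub_moebius stub_anfCircuit (stub_canonFP
  stub_coeffFP stub_anfEmitFP)`) parses EVERY string (`parse`), and — under the guard `k = 2 ∧ n even ∧ n ≤ |x| + 1`,
  idle on the slice — re-emits the canonical XOR-of-ANDs netlists (`anfPC`, genuine circuits `StubAnfCircuit.anfCircuit`)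
  of the degree-3 TRUNCATED MÖBIUS INTERPOLANTS of the two circuit oracles (`cubicMonomials`, `truncOf`; RM(3) algebra
  `stub_moebius`: always cubic, and the identity on cubic functions), otherwise a fixed well-formed code; so its image
  consists of WELL-FORMED cubic codes (`WF`) and exact yes/no codes keep their value;
* on well-formed cubic codes the LANDED signed family `PhaseQuery.family SgnForrMem.paramsS` (Aaronson–Ambainis
  Prop. 6) accepts with probability exactly `1 − (1 − ((1+Φ)/2)²)³`, hence `1` on `Φ = 1` and `≤ p₀ < 1` on `Φ ≠ 1`
  by `NearExactIsExact` (`stub_V`); exact AND-powering of a uniform family (`stub_A`, `K` copies + "all accept"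
  read-out, acceptance `acc^K`) makes `gappedSlice ∈ PromiseBQP` (`gappedSlice_mem_PromiseBQP`);
* the separating language is `f⁻¹(gappedSlice.yes) ∈ BQP` (`mem_PromiseBQP_of_polyTimeReducible`,
  `ofLanguage_mem_PromiseBQP_iff`).

This file also carries PART 2 of stub E (`stub_anfCircuit`): the canonical circuits of `…StubAnfCircuitAux.lean`
COMPUTE `evalMonos` — `Circuit.wireVals` is a left fold (`wireVals_eq_foldl`); for the positional gate list
`(List.range N).map gateAt` it equals `(List.range N).map valAt` once every gate returns its claimed value against the
claimed values of the earlier gates (`foldl_range_eq`, `gval_gateAt`; accumulators `valAt_acc`).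

Sources: [AaronsonAmbainis2018] §3.2 Prop. 6, §6; [Carlet2020] §2.2.1 (binary Möbius transform); [Watrous2009] Prop. 3;
[Goldreich2006] §1.2 / Def. 1.4; [AroraBarak2009] §1.3, §6.1, Rem. 6.4.
-/

set_option linter.dupNamespace false -- D-0017: single-problem summit ⇒ `QuantumAdvantage.QuantumAdvantage` by design

noncomputable section

namespace Summit.QuantumAdvantage.QuantumAdvantage.Theorems.SignedExactSliceIsLift

open _root_.Computability Literature.Computability.Complexity Literature.Computability.Cryptography
  Literature.Computability.QuantumComplexity
open Literature.Computability.Complexity.CodeFP (strE unE natE bitE pairE rawE)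
open Summit.QuantumAdvantage.QuantumAdvantage.Theses.CubicForrelation (NearExactIsExact SignedExactSliceIsLift)

/-! ## Stub E, part 2 (evaluation of the canonical circuits of `…StubAnfCircuitAux.lean`) and the packaged `stub_anfCircuit` -/

namespace StubAnfCircuit

open ForrCode

variable {n : ℕ}

/-! ### Straight-line evaluation of a positional gate list -/

/-- The value of a gate argument against the input `x` and the earlier gate values `vals`. -/
def argV (x : Fin n → Bool) (vals : List Bool) : Fin n ⊕ ℕ → Bool
  | .inl i => x i
  | .inr m => vals.getD m false

/-- A gate reference reads the earlier value. -/
theorem argV_inr (x : Fin n → Bool) (vals : List Bool) (m : ℕ) : argV x vals (Sum.inr m) = vals.getD m false := rfl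

/-- The value of a gate against the input `x` and the earlier gate values `vals` (the step of `Circuit.wireVals`). -/
def gval (x : Fin n → Bool) (vals : List Bool) (g : Gate (Fin n)) : Bool := g.op fun a => argV x vals (g.args a)

/-- `Circuit.wireVals` is the left fold of `gval`. -/
theorem wireVals_eq_foldl (C : Circuit (Fin n)) (x : Fin n → Bool) :
    C.wireVals x = C.gates.foldl (fun vals g => vals ++ [gval x vals g]) [] := by
  unfold Circuit.wireVals gval
  congr 1
  funext vals g
  congr 3
  funext a
  cases g.args a <;> rfl

/-- **Positional evaluation**: if every gate `j < N`, evaluated against the claimed values of the gates `< j`, returns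
its claimed value `V j`, then the fold over `(List.range N).map G` produces `(List.range N).map V`. -/
theorem foldl_range_eq (G : ℕ → Gate (Fin n)) (V : ℕ → Bool) (x : Fin n → Bool) :
    ∀ N : ℕ, (∀ j, j < N → gval x ((List.range j).map V) (G j) = V j) →
      ((List.range N).map G).foldl (fun vals g => vals ++ [gval x vals g]) [] = (List.range N).map V
  | 0, _ => rfl
  | N + 1, h => by
    rw [List.range_succ, List.map_append, List.foldl_append, foldl_range_eq G V x N fun j hj => h j (by omega),
      List.map_append]
    simp only [List.map_cons, List.map_nil, List.foldl_cons, List.foldl_nil, List.cons.injEq, and_true,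
      List.append_cancel_left_eq]
    exact h N (Nat.lt_succ_self N)

/-- Reading a claimed value of an earlier gate. -/
theorem getD_map_range (V : ℕ → Bool) {m j : ℕ} (h : m < j) : ((List.range j).map V).getD m false = V m := by
  rw [List.getD_eq_getElem?_getD, List.getElem?_map, List.getElem?_range h]
  rfl

/-! ### The claimed values -/

/-- The value of the `p`-th literal of monomial `S` (absent literals are `true`). -/
def litV (n : ℕ) (S : List ℕ) (x : Fin n → Bool) (p : ℕ) : Bool :=
  match S.drop p with
  | [] => true
  | i :: _ => litVal n x i

/-- **The claimed value of gate `j`.** -/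
def valAt (n : ℕ) (mons : List (List ℕ)) (x : Fin n → Bool) (j : ℕ) : Bool :=
  if j = 0 then true
  else if j = 1 then false
  else if j - 2 < n then false
  else if (j - (2 + n)) % 3 = 0 then
    litV n (mons.getD ((j - (2 + n)) / 3) []) x 0 && litV n (mons.getD ((j - (2 + n)) / 3) []) x 1
  else if (j - (2 + n)) % 3 = 1 then monoVal n (mons.getD ((j - (2 + n)) / 3) []) x
  else evalMonos n (mons.take ((j - (2 + n)) / 3 + 1)) x

/-- The three literals give the monomial value. -/
theorem monoVal_eq_lits (S : List ℕ) (x : Fin n → Bool) :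
    ((litV n S x 0 && litV n S x 1) && litV n S x 2) = monoVal n S x := by
  rcases S with _ | ⟨a, _ | ⟨b, _ | ⟨c, rest⟩⟩⟩
  · rfl
  · show ((litVal n x a && true) && true) = (litVal n x a && true)
    cases litVal n x a <;> rfl
  · show ((litVal n x a && litVal n x b) && true) = (litVal n x a && (litVal n x b && true))
    cases litVal n x a <;> cases litVal n x b <;> rfl
  · show ((litVal n x a && litVal n x b) && litVal n x c) = (litVal n x a && (litVal n x b && (litVal n x c && true)))
    cases litVal n x a <;> cases litVal n x b <;> cases litVal n x c <;> rfl

/-- Gates `1, …, 1 + n` (the constant `false` and the touch gates) claim `false`. -/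
theorem valAt_false (mons : List (List ℕ)) (x : Fin n → Bool) {j : ℕ} (h1 : 1 ≤ j) (h2 : j < 2 + n) :
    valAt n mons x j = false := by
  unfold valAt
  rw [if_neg (by omega)]
  split_ifs <;> first | rfl | omega

/-- **The accumulators**: gate `1 + n + 3m` claims the XOR of the first `m` monomials. -/
theorem valAt_acc (mons : List (List ℕ)) (x : Fin n → Bool) (m : ℕ) :
    valAt n mons x (1 + n + 3 * m) = evalMonos n (mons.take m) x := by
  rcases Nat.eq_zero_or_pos m with rfl | hm
  · rw [valAt_false mons x (by omega) (by omega), List.take_zero]; rfl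
  · unfold valAt
    rw [if_neg (by omega), if_neg (by omega), if_neg (by omega), if_neg (by omega), if_neg (by omega),
      show (1 + n + 3 * m - (2 + n)) / 3 + 1 = m by omega]

/-- A literal argument evaluates, against the claimed values, to the literal value. -/
theorem argV_litArg (mons : List (List ℕ)) (x : Fin n → Bool) (S : List ℕ) (p : ℕ) {j : ℕ} (hj : 2 ≤ j) :
    argV x ((List.range j).map (valAt n mons x)) (litArg n S p) = litV n S x p := by
  unfold litArg litV
  by_cases hp : p < S.length
  · rw [if_pos hp, List.drop_eq_getElem_cons hp, List.getD_eq_getElem _ _ hp]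
    simp only [litVal]
    split_ifs with hi
    · rfl
    · rw [argV, getD_map_range _ (by omega : 1 < j)]; rfl
  · rw [if_neg hp, List.drop_eq_nil_of_le (by omega), argV, getD_map_range _ (by omega : 0 < j)]; rfl

/-- **Every gate returns its claimed value.** -/
theorem gval_gateAt (mons : List (List ℕ)) (x : Fin n → Bool) (j : ℕ) (hj : j < N n mons) :
    gval x ((List.range j).map (valAt n mons x)) (gateAt n mons j) = valAt n mons x j := by
  rw [N] at hj
  by_cases h0 : j = 0
  · subst h0; rfl
  by_cases h1 : j = 1
  · subst h1; rfl
  by_cases ht : j - 2 < n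
  · have e : gateAt n mons j = projGate (Sum.inr (1 + (j - 2))) (Sum.inl ⟨j - 2, ht⟩) := by
      rw [gateAt, if_neg h0, if_neg h1, dif_pos ht]
    rw [e, valAt_false mons x (by omega) (by omega)]
    simp only [gval, projGate, Fin.isValue, Matrix.cons_val_zero, argV_inr]
    rw [getD_map_range _ (by omega : 1 + (j - 2) < j)]
    exact valAt_false mons x (by omega) (by omega)
  -- the block gates: `j = 2 + n + r`, block `c = r / 3 < #mons`
  have hr : 2 + n ≤ j := by omega
  by_cases hA : (j - (2 + n)) % 3 = 0
  · have e : gateAt n mons j = andGate (litArg n (mons.getD ((j - (2 + n)) / 3) []) 0)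
        (litArg n (mons.getD ((j - (2 + n)) / 3) []) 1) := by
      rw [gateAt, if_neg h0, if_neg h1, dif_neg ht, if_pos hA]
    have ev : valAt n mons x j = (litV n (mons.getD ((j - (2 + n)) / 3) []) x 0 &&
        litV n (mons.getD ((j - (2 + n)) / 3) []) x 1) := by
      rw [valAt, if_neg h0, if_neg h1, if_neg ht, if_pos hA]
    rw [e, ev]
    simp only [gval, andGate, Fin.isValue, Matrix.cons_val_zero, Matrix.cons_val_one]
    rw [argV_litArg mons x _ 0 (by omega), argV_litArg mons x _ 1 (by omega)]
  by_cases hB : (j - (2 + n)) % 3 = 1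
  · have e : gateAt n mons j = andGate (Sum.inr (2 + n + 3 * ((j - (2 + n)) / 3)))
        (litArg n (mons.getD ((j - (2 + n)) / 3) []) 2) := by
      rw [gateAt, if_neg h0, if_neg h1, dif_neg ht, if_neg hA, if_pos hB]
    have ev : valAt n mons x j = monoVal n (mons.getD ((j - (2 + n)) / 3) []) x := by
      rw [valAt, if_neg h0, if_neg h1, if_neg ht, if_neg hA, if_pos hB]
    -- the claimed value of the `A` gate of the same block
    have eA : valAt n mons x (2 + n + 3 * ((j - (2 + n)) / 3)) =
        (litV n (mons.getD ((j - (2 + n)) / 3) []) x 0 && litV n (mons.getD ((j - (2 + n)) / 3) []) x 1) := by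
      rw [valAt, if_neg (by omega), if_neg (by omega), if_neg (by omega),
        show 2 + n + 3 * ((j - (2 + n)) / 3) - (2 + n) = 3 * ((j - (2 + n)) / 3) by omega,
        if_pos (by omega), show 3 * ((j - (2 + n)) / 3) / 3 = (j - (2 + n)) / 3 by omega]
    rw [e, ev]
    simp only [gval, andGate, Fin.isValue, Matrix.cons_val_zero, Matrix.cons_val_one, argV_inr]
    rw [getD_map_range _ (by omega), eA, argV_litArg mons x _ 2 (by omega), monoVal_eq_lits]
  · have hC : (j - (2 + n)) % 3 = 2 := by omega
    have e : gateAt n mons j = xorGate (Sum.inr (1 + n + 3 * ((j - (2 + n)) / 3)))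
        (Sum.inr (3 + n + 3 * ((j - (2 + n)) / 3))) := by
      rw [gateAt, if_neg h0, if_neg h1, dif_neg ht, if_neg hA, if_neg hB]
    have ev : valAt n mons x j = evalMonos n (mons.take ((j - (2 + n)) / 3 + 1)) x := by
      rw [valAt, if_neg h0, if_neg h1, if_neg ht, if_neg hA, if_neg hB]
    -- the claimed value of the `B` gate of the same block
    have eB : valAt n mons x (3 + n + 3 * ((j - (2 + n)) / 3)) = monoVal n (mons.getD ((j - (2 + n)) / 3) []) x := by
      rw [valAt, if_neg (by omega), if_neg (by omega), if_neg (by omega),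
        show 3 + n + 3 * ((j - (2 + n)) / 3) - (2 + n) = 3 * ((j - (2 + n)) / 3) + 1 by omega,
        if_neg (by omega), if_pos (by omega), show (3 * ((j - (2 + n)) / 3) + 1) / 3 = (j - (2 + n)) / 3 by omega]
    have hc : (j - (2 + n)) / 3 < mons.length := by omega
    rw [e, ev]
    simp only [gval, xorGate, Fin.isValue, Matrix.cons_val_zero, Matrix.cons_val_one, argV_inr]
    rw [getD_map_range _ (by omega), getD_map_range _ (by omega), valAt_acc, eB, List.take_add_one,
      List.getElem?_eq_getElem hc, Option.toList_some, evalMonos, evalMonos, List.foldl_append, List.foldl_cons,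
      List.foldl_nil, List.getD_eq_getElem _ _ hc]

/-- **The canonical circuit computes `evalMonos`.** -/
theorem eval_anfCircuit (mons : List (List ℕ)) (x : Fin n → Bool) : (anfCircuit n mons).eval x = evalMonos n mons x := by
  have hw : (anfCircuit n mons).wireVals x = (List.range (N n mons)).map (valAt n mons x) := by
    rw [wireVals_eq_foldl, anfCircuit_gates]
    exact foldl_range_eq _ _ _ _ fun j hj => gval_gateAt mons x j hj
  show ((anfCircuit n mons).wireVals x).getD (1 + n + 3 * mons.length) false = _
  rw [hw, getD_map_range _ (by rw [N]; omega), valAt_acc, List.take_length]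

end StubAnfCircuit

open StubAnfCircuit in
/-- STUB E (netlist semantics): genuine circuits over `B₂` computing `evalMonos`, reading every input wire, with mirror
`anfPC` (gate layout fixed in the Defs file: constants, `n` touch gates, one 3-gate block per monomial). -/
theorem stub_anfCircuit : ∃ E : (n : ℕ) → List (List ℕ) → Circuit (Fin n),
    (∀ n mons, (E n mons).IsOver B2) ∧
    (∀ n mons x, (E n mons).eval x = evalMonos n mons x) ∧
    (∀ n mons j, j < n → j ∈ ForrMem.readsC (E n mons)) ∧
    (∀ n mons, ForrCode.pcircOf (E n mons) = anfPC n mons) :=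
  ⟨fun n mons => anfCircuit n mons, fun _ mons => anfCircuit_isOver mons, fun _ mons x => eval_anfCircuit mons x,
    fun _ mons j hj => mem_readsC_anfCircuit mons j hj, fun _ mons => pcircOf_anfCircuit mons⟩


/-! ## The composition -/

/-- **Lift by a total reduction.** If `f ∈ FP` maps every string into the promise of some `Q' ∈ PromiseBQP`
(disjoint), yes to yes and no to no, then `Q ∈ promiseLift BQP`, witnessed by the honest language `L = f⁻¹(Q'.yes)`:
`ofLanguage L ≤ₚ Q'` because OFF `L` the image still lies in the promise, hence in `Q'.no`. -/
theorem promiseLift_of_total_reduction {Q Q' : PromiseProblem} (hQ' : Q' ∈ PromiseBQP)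
    (hdis : Disjoint Q'.yes Q'.no) {f : List Bool → List Bool} (hf : f ∈ FP)
    (htot : ∀ x, f x ∈ Q'.yes ∨ f x ∈ Q'.no) (hy : Set.MapsTo f Q.yes Q'.yes)
    (hn : Set.MapsTo f Q.no Q'.no) : Q ∈ promiseLift BQP := by
  refine ⟨f ⁻¹' Q'.yes, ?_, fun x hx => hy hx, fun x hx hx' => ?_⟩
  · rw [← ofLanguage_mem_PromiseBQP_iff]
    refine mem_PromiseBQP_of_polyTimeReducible ⟨f, hf, fun x hx => hx, fun x hx => ?_⟩ hQ'
    exact (htot x).resolve_left hx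
  · exact Set.disjoint_left.1 hdis hx' (hn hx)

/-- The gapped slice is disjoint (`encode` is injective; `value = 1` vs `value ≠ 1`). -/
theorem gappedSlice_disjoint : Disjoint gappedSlice.yes gappedSlice.no := by
  refine Set.disjoint_left.2 ?_
  rintro x ⟨I, hI, rfl⟩ ⟨J, hJ, hJI⟩
  obtain rfl := KForrelationInstance.encode_injective hJI
  exact hJ.2 hI.2.1

/-- **The gapped slice is in `PromiseBQP`** (from `stub_V` and `stub_A`): the top value `1` is a fixed point of
AND-powering and `p₀^K ≤ 1/3`. -/
theorem gappedSlice_mem_PromiseBQP (hNE : NearExactIsExact) : gappedSlice ∈ PromiseBQP := by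
  obtain ⟨p₀, hp₀, hyes, hno⟩ := stub_V hNE
  set q : ℝ := max p₀ 0 with hq
  have hq0 : 0 ≤ q := le_max_right _ _
  have hq1 : q < 1 := max_lt hp₀ one_pos
  obtain ⟨K, hK⟩ := exists_pow_lt_of_lt_one (show (0 : ℝ) < 1 / 3 by norm_num) hq1
  have hKpos : 0 < K := by
    rcases Nat.eq_zero_or_pos K with h | h
    · subst h; norm_num at hK
    · exact h
  obtain ⟨F', hF', hU', hacc⟩ := stub_A (PhaseQuery.family SgnForrMem.paramsS)
    (PhaseQuery.family_isOracleFree SgnForrMem.paramsS) (PhaseQuery.family_isUniform SgnForrMem.paramsS) K hKpos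
  refine ⟨F', hF', hU', fun x hx => ?_, fun x hx => ?_⟩
  · rw [hacc, hyes x hx, one_pow]; norm_num
  · rw [hacc]
    have h0 : 0 ≤ (PhaseQuery.family SgnForrMem.paramsS).acceptProbOn 0 x :=
      QCircuitFamily.acceptProbOn_nonneg _ _ _
    have h1 : (PhaseQuery.family SgnForrMem.paramsS).acceptProbOn 0 x ≤ q :=
      (hno x hx).trans (le_max_left _ _)
    calc (PhaseQuery.family SgnForrMem.paramsS).acceptProbOn 0 x ^ K ≤ q ^ K := pow_le_pow_left₀ h0 h1 K
      _ ≤ 1 / 3 := hK.le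

/-- **The total canonicaliser** (from the classical stubs: Möbius algebra, netlist circuits, netlist/coefficient/front-end
`CodeFP` certificates, and the glue). -/
theorem totalCanonicaliser : ∃ f ∈ FP, (∀ x, f x ∈ gappedSlice.yes ∨ f x ∈ gappedSlice.no) ∧
    Set.MapsTo f slice.yes gappedSlice.yes ∧ Set.MapsTo f slice.no gappedSlice.no :=
  stub_glue stub_moebius stub_anfCircuit (stub_canonFP stub_coeffFP stub_anfEmitFP)

/-- **K2 holds**: `NearExactIsExact → slice ∈ promiseLift BQP` (literally the route decl). -/
theorem signedExactSliceIsLift_holds : SignedExactSliceIsLift := by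
  intro hNE
  obtain ⟨f, hf, htot, hy, hn⟩ := totalCanonicaliser
  exact promiseLift_of_total_reduction (gappedSlice_mem_PromiseBQP hNE) gappedSlice_disjoint hf htot hy hn

end Summit.QuantumAdvantage.QuantumAdvantage.Theorems.SignedExactSliceIsLift

namespace Summit.QuantumAdvantage.QuantumAdvantage.Theorems

/-- **Crux K2 `SignedExactSliceIsLift` (stmt-QuantumAdvantage-14830)**: `NearExactIsExact →` the signed exact cubic
slice `∈ promiseLift BQP` — line `Sketch` (reduce-then-lift), by name. -/
theorem SignedExactSliceIsLift_proof :
    Summit.QuantumAdvantage.QuantumAdvantage.Theses.CubicForrelation.SignedExactSliceIsLift :=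
  SignedExactSliceIsLift.signedExactSliceIsLift_holds

end Summit.QuantumAdvantage.QuantumAdvantage.Theorems

end
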